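import Summits.CriticalPhenomena.PercolationContinuityZ3.Theorems.Transplant.SiteUnfoldMain
import Summits.CriticalPhenomena.PercolationContinuityZ3.Theorems.Transplant.SiteS5Assembly
import HarnessLib

/-!
# SITE percolation: `SiteCSHAll` (hence `SiteAdditiveGluing`, site Conjecture 3) from site LEMMA T ALONE — the level-zero socket
# `hBase` (site MDL(X), WP2 of P1-SITE-Z3 §12) is NOT an independent input
# (lane `prim-bschramm`, class C1a; prover `prim-hp-8` gen 16 for the lane's WP plan)

builds on p205010 (kernel theorem, internal audit signed; external expert review pending).

The site induction skeleton `SiteCSH.siteCSHAll_of_unfold` (p211724) takes three sockets: `hBase` (site MDL(X): the decoy-free margin),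
`hT` (site LEMMA T: margin ⟸ world-wise "within" margin) and `hU` (site LEMMAS U + H: within margin ⟸ lower-level margins, `D ≠ []`).
`hU` is the tree theorem `SiteCSH.siteWithin_nonneg_of_lower` (p214944), whose side conditions (`x ∉ Y`, …, `D ≠ []`) are unused.
OBSERVATION (this file): at `D = []` the within margin IS the H-part of site Lemma H at `S = {x}` (site Lemma U has no sub-data),
so `0 ≤ siteWithin Γ q x Y [] o v g` for every monotone `g ≥ 0` UNCONDITIONALLY (`siteWithin_nil_nonneg`), and site Lemma T at
`D = []` turns it into the level-zero margin: **site MDL(X) = Lemma T(D = []) ∘ Lemma H(S = {x})** (`cshMargin_nil_nonneg_of_lemmaT`).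
Consequently the whole site finite leg hangs on ONE remaining socket, site Lemma T in the exact shape `hT` of the skeleton:
* `siteCSHAll_of_lemmaT : (∀ n Γ q, non-degenerate → hT) → SiteCSHAll`;
* `siteAdditiveGluing_of_lemmaT`, `siteNearOneGluing_of_lemmaT` (site KN Conjecture 1 / Conjecture 3 from site Lemma T, via p210511);
* `sitePercolationContinuityZ3_of_lemmaT` (with the two site ℤ³ inputs of the Thm-6 skeleton).
The bond level zero was proved by a separate chain (`CovTau.markerDominanceAvoid` ← HullPort `T_A ≥ 0`); for the site re-typing that
chain (≈ 2.5 k lines) is hereby unnecessary.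
Support file (`--supports stmt-CriticalPhenomena-4575 --as helper`); no definitions, no named facts, no sorries.
[cite: VandenbergHaggstromKahn2005, §2.1 (pp. 9–13)] [cite: KozmaNitzan2024, Conj. 1 (p. 3), Conj. 3 (p. 15), Conj. 4 (p. 32)]
-/

noncomputable section

namespace Summit.CriticalPhenomena.PercolationContinuityZ3.Theorems.Transplant

namespace SiteCSH

open MeasureTheory Set
open Literature.Probability.LatticeModels (prodBernoulli)
open Literature.Probability.Percolation
open Summit.CriticalPhenomena.PercolationContinuityZ3.Theorems.SiteTransplant (SiteAdditiveGluing SiteNearOneGluing SiteAGloc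
  SiteSlabPercolation SiteBGN)
open scoped Classical

variable {n : ℕ} {Δ : SimpleGraph (Fin n)}

/-- **The decoy-free site within margin is nonnegative, unconditionally** (every `x, Y, o, v`, every monotone `g ≥ 0`, non-degenerate
weights): at `D = []` site Lemma U has no sub-data and the within margin is the H-part of site Lemma H at `S = {x}`
(`SiteCSH.siteWithin_nonneg_of_lower`, p214944, whose side conditions are idle). [cite: VandenbergHaggstromKahn2005, §2.1 (pp. 9–13)] -/
theorem siteWithin_nil_nonneg (q : Fin n → unitInterval) (hq : ∀ u, 0 < q u ∧ q u < 1) (x : Fin n) (Y : Set (Fin n)) (o v : Fin n)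
    (g : Set (Fin n) → ℝ) (hg : Monotone g) (hg0 : ∀ C, 0 ≤ g C) :
    0 ≤ siteWithin Δ q x Y [] o v g :=
  within_nonneg_of_hpart (Γ := Δ) q hq x Y [] o v hg
    (fun pre d ds' h => absurd h (by simp))
    (by
      have hS : ((↑(insert x ([] : List (Fin n)).toFinset) : Set (Fin n)) ∪ Y) = insert x Y ∪ {d | d ∈ ([] : List (Fin n))} := by
        ext u
        simp only [List.toFinset_nil, insert_empty_eq, Finset.coe_singleton, singleton_union, List.not_mem_nil, setOf_false,
          union_empty]
      have key := SiteCovTau.siteHpart_nonneg (Δ := Δ) q hq x Y (insert x ([] : List (Fin n)).toFinset) (Finset.mem_insert_self x _)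
        o v g (fun C C' h => hg h) hg0
      rw [hS] at key
      convert key using 20)

/-- **Site MDL(X) from site LEMMA T at `D = []`**: if the decoy-free margin follows from the decoy-free within margin (the `D = []`
instance of the socket `hT` of `SiteCSH.siteCSHAll_of_unfold`), then the decoy-free margin `CSH(Y; x; ∅; o, v)[f]` is nonnegative for
every monotone `f` — the socket `hBase` (site MDL(X)), with no further input. [cite: KozmaNitzan2024, Conj. 4 (p. 32)] -/
theorem cshMargin_nil_nonneg_of_lemmaT (q : Fin n → unitInterval) (hq : ∀ u, 0 < q u ∧ q u < 1) (x : Fin n) (Y : Set (Fin n))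
    (o v : Fin n)
    (hT : (∀ g : Set (Fin n) → ℝ, Monotone g → (∀ C, 0 ≤ g C) → 0 ≤ siteWithin Δ q x Y [] o v g) →
      ∀ f : Set (Fin n) → ℝ, Monotone f → 0 ≤ cshMargin Δ q x Y [] o v f)
    (f : Set (Fin n) → ℝ) (hf : Monotone f) : 0 ≤ cshMargin Δ q x Y [] o v f :=
  hT (fun g hg hg0 => siteWithin_nil_nonneg q hq x Y o v g hg hg0) f hf

/-- **`SiteCSHAll` from site LEMMA T alone.**  If, on every finite graph with non-degenerate vertex weights, the site CSH margin of
every datum `(x, Y, D, o, v)` is nonnegative for all monotone `f` as soon as its world-wise within margin is nonnegative for all monotone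
`g ≥ 0` (the socket `hT` of `SiteCSH.siteCSHAll_of_unfold`, verbatim), then `SiteCSHAll`: `hBase` by `cshMargin_nil_nonneg_of_lemmaT`,
`hU` by `siteWithin_nonneg_of_lower` (p214944). [cite: VandenbergHaggstromKahn2005, §2.1 (pp. 9–13)] [cite: KozmaNitzan2024, Conj. 4 (p. 32)] -/
theorem siteCSHAll_of_lemmaT
    (hT : ∀ (n : ℕ) (Γ : SimpleGraph (Fin n)) (q : Fin n → unitInterval), (∀ u, 0 < q u ∧ q u < 1) →
      ∀ (x : Fin n) (Y : Set (Fin n)) (D : List (Fin n)) (o v : Fin n),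
        (∀ g : Set (Fin n) → ℝ, Monotone g → (∀ C, 0 ≤ g C) → 0 ≤ siteWithin Γ q x Y D o v g) →
        ∀ f : Set (Fin n) → ℝ, Monotone f → 0 ≤ cshMargin Γ q x Y D o v f) :
    SiteCSHAll :=
  siteCSHAll_of_unfold fun n Γ q hq =>
    ⟨fun x Y o v _ f hf => cshMargin_nil_nonneg_of_lemmaT (Δ := Γ) q hq x Y o v (hT n Γ q hq x Y [] o v) f hf,
      hT n Γ q hq,
      fun x Y D o v hxY ho hv hov hne hnd hdis hIH g hg hg0 =>
        siteWithin_nonneg_of_lower (Δ := Γ) q hq x Y D o v hxY ho hv hov hne hnd hdis hIH g hg hg0⟩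

/-- **`SiteAdditiveGluing` (site Kozma–Nitzan Conjecture 1) from site LEMMA T alone** (via `siteAdditiveGluing_of_siteCSHAll`, p210511).
[cite: KozmaNitzan2024, Conj. 1 (p. 3), Conj. 4 (p. 32)] -/
theorem siteAdditiveGluing_of_lemmaT
    (hT : ∀ (n : ℕ) (Γ : SimpleGraph (Fin n)) (q : Fin n → unitInterval), (∀ u, 0 < q u ∧ q u < 1) →
      ∀ (x : Fin n) (Y : Set (Fin n)) (D : List (Fin n)) (o v : Fin n),
        (∀ g : Set (Fin n) → ℝ, Monotone g → (∀ C, 0 ≤ g C) → 0 ≤ siteWithin Γ q x Y D o v g) →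
        ∀ f : Set (Fin n) → ℝ, Monotone f → 0 ≤ cshMargin Γ q x Y D o v f) :
    SiteAdditiveGluing :=
  siteAdditiveGluing_of_siteCSHAll (siteCSHAll_of_lemmaT hT)

/-- **`SiteNearOneGluing` (site Kozma–Nitzan Conjecture 3) from site LEMMA T alone** (via `siteNearOneGluing_of_siteCSHAll`, p210511).
[cite: KozmaNitzan2024, Conj. 3 (p. 15), Conj. 4 (p. 32)] -/
theorem siteNearOneGluing_of_lemmaT
    (hT : ∀ (n : ℕ) (Γ : SimpleGraph (Fin n)) (q : Fin n → unitInterval), (∀ u, 0 < q u ∧ q u < 1) →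
      ∀ (x : Fin n) (Y : Set (Fin n)) (D : List (Fin n)) (o v : Fin n),
        (∀ g : Set (Fin n) → ℝ, Monotone g → (∀ C, 0 ≤ g C) → 0 ≤ siteWithin Γ q x Y D o v g) →
        ∀ f : Set (Fin n) → ℝ, Monotone f → 0 ≤ cshMargin Γ q x Y D o v f) :
    SiteNearOneGluing :=
  siteNearOneGluing_of_siteCSHAll (siteCSHAll_of_lemmaT hT)

/-- **Site `θ_{ℤ³}(p_c^site) = 0` from site LEMMA T and the two site ℤ³ inputs of the Thm-6 skeleton** (`SiteSlabPercolation`, `SiteBGN`;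
via `sitePercolationContinuityZ3_of_siteCSHAll`, p210511). [cite: KozmaNitzan2024, Thm. 6 with Conj. 3 (p. 15)] -/
theorem sitePercolationContinuityZ3_of_lemmaT (hslab : SiteSlabPercolation) (hBGN : SiteBGN)
    (hT : ∀ (n : ℕ) (Γ : SimpleGraph (Fin n)) (q : Fin n → unitInterval), (∀ u, 0 < q u ∧ q u < 1) →
      ∀ (x : Fin n) (Y : Set (Fin n)) (D : List (Fin n)) (o v : Fin n),
        (∀ g : Set (Fin n) → ℝ, Monotone g → (∀ C, 0 ≤ g C) → 0 ≤ siteWithin Γ q x Y D o v g) →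
        ∀ f : Set (Fin n) → ℝ, Monotone f → 0 ≤ cshMargin Γ q x Y D o v f) :
    SitePercolationContinuityZ3 :=
  sitePercolationContinuityZ3_of_siteCSHAll hslab hBGN (siteCSHAll_of_lemmaT hT)

end SiteCSH

end Summit.CriticalPhenomena.PercolationContinuityZ3.Theorems.Transplant

end
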